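import Summits.Ventures.LatticeQCDFlow.Scaling.CycleEndHubBracket

/-!
HONEST FRAMING: exact (Metropolis-corrected) sampling algorithms for lattice gauge theory; figures
of merit are autocorrelation/cost numbers at stated couplings and volumes; no continuum-physics
claim.

# UrnDeletionCoupling — THE `τ = ∞` CARICATURE OF THE REFRESH CYCLE: WITH DELETION LAWS `u(v) = (N(v)/W(v))/Z`, `Z = Σ_v N(v)/W(v)`, THE OPTIMAL COUPLING
# NEVER INCREASES THE COMPOSITION DISTANCE AND CONTRACTS IT BY `1 − p/min{Z_X, Z_Y}` PER CYCLE (`p·W ≤ 1`) (lean-2 GEN-35, ours)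

Venture-side (OURS).  Cell `lqcd-flow` (pub-lqcd), unit `pub-lqcd-lean-2-g35`, 2026-08-29.  Chapter V (composition variables), file 3: the instance of file 2
(`CycleEndHubBracket`) for the URN — the limit of infinitely many swap attempts per refresh cycle of the homogeneous `q`-content star, in which the cycle-end hub
content of a copy with full composition `N` is drawn with probability proportional to `N(v)/W(v)` (`W = μ_1/μ_0` the persistence; `lean-2/MEMO-gen34-persistence-weights.md`
§7, there pencil only).  With `Z = Σ_v N(v)/W(v)` and hub domination `p·W ≤ 1`: (a) if `Z_Y ≤ Z_X` then `u_Y(a) < u_X(a)` forces `N_Y(a) < N_X(a)` (`a ∈ A`), and if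
`Z_X ≤ Z_Y` then `u_X(b) < u_Y(b)` forces `b ∈ B` — so by file 2 §4 the optimal coupling of the two deletions NEVER increases `Δ`; (b) the gain is
`G ≥ p·Δ/min{Z_X, Z_Y}`: `E[Δ'] ≤ (1 − p/min{Z_X,Z_Y})·Δ` — the conjectured order `p/(K+1)` whenever ONE copy has `Z = O(K)`, degraded only by a DOUBLE pool of impersistent
particles (`Z ≤ (K+1)/W_lo`, so never worse than `1 − p·W_lo/(K+1)`).  Hypothesis-equations (`hΔ`, `hZX`, `huX`, survivors), no definitions, no chain.

## What is proved

* §1 `urn_law_nonneg`, `urn_law_sum_eq_one`, `urn_Z_pos`, `urn_Z_le` (`Z ≤ (Σ_v N(v))/W_lo`).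
* §2 **`urn_memA_of_law_lt`** (`Z_Y ≤ Z_X`, `u_Y(a) < u_X(a) ⇒ N_Y(a) < N_X(a)`), **`urn_memB_of_law_lt`** (`Z_X ≤ Z_Y`, `u_X(b) < u_Y(b) ⇒ N_X(b) < N_Y(b)`),
  **`urn_monotone`** (on the support of the optimal coupling `Δ(survivors) ≤ Δ(N_X,N_Y)`, either ordering of `Z_X, Z_Y`).
* §3 `urn_posPart_C_eq_zero` (no `C`-discrepancy against the copy with the larger `Z`), **`urn_gain_ge_of_le`** (`Z_X ≤ Z_Y ⇒ G ≥ p·Δ(N_X,N_Y)/Z_X`),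
  **`urn_gain_ge_of_ge`** (`Z_Y ≤ Z_X ⇒ G ≥ p·Δ(N_X,N_Y)/Z_Y`, equal totals), **`urn_gain_ge_min`** (`G ≥ p·Δ/min{Z_X,Z_Y}`).
* §4 **`urn_bracket_le`** — `E_opt[Δ(survivors)] ≤ Δ(N_X,N_Y) − p·Δ(N_X,N_Y)/min{Z_X,Z_Y}`; `urn_bracket_le_uniform` — with `W_lo ≤ W` and `Σ_v N_X(v) = Σ_v N_Y(v) = T`:
  `E_opt[Δ'] ≤ (1 − p·W_lo/T)·Δ`.

Reading (no numerics implied): this is the exact one-cycle statement behind memo-34 §7's «the multiset distance contracts per cycle by `1 − p/min{Z_X,Z_Y}`»; the law-free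
order `p/(K+1)` needs in addition a one-copy environment potential paying for the drain of a double pool (toy: `lean-2/work-gen35/numerics/cyclehub.py`, NOTHING CLAIMED).
NOT CLAIMED: anything at finite swap odds; any mixing-time statement for the star.  Literature grade (cell rule): OWN, elementary; nothing cited as a fact; no new bib keys.
-/

open Finset
open Literature.Probability.MarkovChains

namespace Summit.Ventures.LatticeQCDFlow.Scaling

section Urn
variable {S : Type*} [Fintype S] [DecidableEq S] {Δ : (S → ℕ) → (S → ℕ) → ℕ}
variable {W : S → ℝ} {p ZX ZY : ℝ} {NX NY : S → ℕ} {uX uY : S → ℝ}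

/-! ## §1 The urn deletion law -/

omit [DecidableEq S] in
/-- `Z > 0` as soon as the composition is non-empty. [ours] -/
theorem urn_Z_pos (hW : ∀ v, 0 < W v) (hZX : ZX = ∑ v, (NX v : ℝ) / W v) (hne : ∃ v, NX v ≠ 0) : 0 < ZX := by
  obtain ⟨v, hv⟩ := hne
  rw [hZX]
  refine lt_of_lt_of_le ?_ (single_le_sum (f := fun v => (NX v : ℝ) / W v) (fun u _ => div_nonneg (Nat.cast_nonneg _) (hW u).le) (mem_univ v))
  exact div_pos (by exact_mod_cast Nat.pos_of_ne_zero hv) (hW v)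

omit [Fintype S] [DecidableEq S] in
/-- The urn law is non-negative. [ours] -/
theorem urn_law_nonneg (hW : ∀ v, 0 < W v) (hZX0 : 0 < ZX) (huX : ∀ v, uX v = (NX v : ℝ) / W v / ZX) (v : S) : 0 ≤ uX v := by
  rw [huX]; exact div_nonneg (div_nonneg (Nat.cast_nonneg _) (hW v).le) hZX0.le

omit [DecidableEq S] in
/-- The urn law has mass one. [ours] -/
theorem urn_law_sum_eq_one (hZX : ZX = ∑ v, (NX v : ℝ) / W v) (hZX0 : 0 < ZX) (huX : ∀ v, uX v = (NX v : ℝ) / W v / ZX) :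
    ∑ v, uX v = 1 := by
  simp_rw [huX]
  rw [← sum_div, ← hZX, div_self hZX0.ne']

omit [DecidableEq S] in
/-- **`Z ≤ (Σ_v N(v))/W_lo`** when `W ≥ W_lo > 0`: the inverse-weight mass of `K + 1` particles is at most `(K+1)/W_lo`. [ours] -/
theorem urn_Z_le (hZX : ZX = ∑ v, (NX v : ℝ) / W v) {Wlo : ℝ} (hWlo : 0 < Wlo) (hWge : ∀ v, Wlo ≤ W v) :
    ZX ≤ (∑ v, (NX v : ℝ)) / Wlo := by
  rw [hZX, sum_div]
  exact sum_le_sum fun v _ => div_le_div_of_nonneg_left (Nat.cast_nonneg _) hWlo (hWge v)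

/-! ## §2 Monotonicity: the copy with the larger `Z` only over-deletes its own surplus -/

omit [Fintype S] [DecidableEq S] in
/-- **`Z_Y ≤ Z_X` and `u_Y(a) < u_X(a)` force `N_Y(a) < N_X(a)`** (`a ∈ A`): the copy with the larger normaliser puts LESS weight on every shared content. [ours] -/
theorem urn_memA_of_law_lt (hW : ∀ v, 0 < W v) (hZX0 : 0 < ZX) (hZY0 : 0 < ZY)
    (huX : ∀ v, uX v = (NX v : ℝ) / W v / ZX) (huY : ∀ v, uY v = (NY v : ℝ) / W v / ZY) (hZ : ZY ≤ ZX) {a : S} (h : uY a < uX a) :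
    NY a < NX a := by
  by_contra hle
  have hle' : (NX a : ℝ) ≤ NY a := by exact_mod_cast not_lt.mp hle
  rw [huX, huY] at h
  have h1 : (NX a : ℝ) / W a / ZX ≤ (NY a : ℝ) / W a / ZX :=
    div_le_div_of_nonneg_right (div_le_div_of_nonneg_right hle' (hW a).le) hZX0.le
  have h2 : (NY a : ℝ) / W a / ZX ≤ (NY a : ℝ) / W a / ZY :=
    div_le_div_of_nonneg_left (div_nonneg (Nat.cast_nonneg _) (hW a).le) hZY0 hZ
  linarith

omit [Fintype S] [DecidableEq S] in
/-- **`Z_X ≤ Z_Y` and `u_X(b) < u_Y(b)` force `N_X(b) < N_Y(b)`** (`b ∈ B`). [ours] -/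
theorem urn_memB_of_law_lt (hW : ∀ v, 0 < W v) (hZX0 : 0 < ZX) (hZY0 : 0 < ZY)
    (huX : ∀ v, uX v = (NX v : ℝ) / W v / ZX) (huY : ∀ v, uY v = (NY v : ℝ) / W v / ZY) (hZ : ZX ≤ ZY) {b : S} (h : uX b < uY b) :
    NX b < NY b :=
  urn_memA_of_law_lt (NX := NY) (NY := NX) hW hZY0 hZX0 huY huX hZ h

/-- **THE URN'S OPTIMAL COUPLING NEVER INCREASES THE COMPOSITION DISTANCE** (pointwise on its support, either ordering of `Z_X, Z_Y`). [ours] -/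
theorem urn_monotone (hΔ : ∀ N N', Δ N N' = ∑ v, (N v - N' v)) (MX MY : S → S → ℕ) (hW : ∀ v, 0 < W v) (hZX0 : 0 < ZX) (hZY0 : 0 < ZY)
    (huX : ∀ v, uX v = (NX v : ℝ) / W v / ZX) (huY : ∀ v, uY v = (NY v : ℝ) / W v / ZY)
    (hMX : ∀ a, uX a ≠ 0 → NX = MX a + Pi.single a 1) (hMY : ∀ b, uY b ≠ 0 → NY = MY b + Pi.single b 1)
    {a b : S} (hq : optimalCoupling uX uY a b ≠ 0) : Δ (MX a) (MY b) ≤ Δ NX NY := by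
  have h0X := urn_law_nonneg hW hZX0 huX
  have h0Y := urn_law_nonneg hW hZY0 huY
  rcases le_total ZX ZY with hZ | hZ
  · exact hubBracket_monotone_of_B hΔ NX NY MX MY h0X h0Y hMX hMY (fun b hb => urn_memB_of_law_lt hW hZX0 hZY0 huX huY hZ hb) hq
  · exact hubBracket_monotone_of_A hΔ NX NY MX MY h0X h0Y hMX hMY (fun a ha => urn_memA_of_law_lt hW hZX0 hZY0 huX huY hZ ha) hq

/-! ## §3 The gain: `G ≥ p·Δ/min{Z_X, Z_Y}` -/

omit [DecidableEq S] in
/-- Against the copy with the larger normaliser there is no `C`-discrepancy: `Z_X ≤ Z_Y ⇒ Σ_C (u_Y − u_X)⁺ = 0`. [ours] -/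
theorem urn_posPart_C_eq_zero (hW : ∀ v, 0 < W v) (hZX0 : 0 < ZX)
    (huX : ∀ v, uX v = (NX v : ℝ) / W v / ZX) (huY : ∀ v, uY v = (NY v : ℝ) / W v / ZY) (hZ : ZX ≤ ZY) :
    ∑ v, max (uY v - uX v) 0 * (if NX v = NY v then (1 : ℝ) else 0) = 0 := by
  refine sum_eq_zero fun v _ => ?_
  by_cases hc : NX v = NY v
  · rw [if_pos hc, mul_one, max_eq_right]
    rw [huX, huY, hc, sub_nonpos]
    exact div_le_div_of_nonneg_left (div_nonneg (Nat.cast_nonneg _) (hW v).le) hZX0 hZ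
  · rw [if_neg hc, mul_zero]

omit [DecidableEq S] in
/-- **`Z_X ≤ Z_Y ⇒ G ≥ p·Δ(N_X,N_Y)/Z_X`** (form `u_X(A) − u_Y(A) − Σ_C (u_Y − u_X)⁺`; on `A` the difference of laws is at least `(N_X − N_Y)/(W·Z_X) ≥ p(N_X − N_Y)/Z_X`). [ours] -/
theorem urn_gain_ge_of_le (hΔ : ∀ N N', Δ N N' = ∑ v, (N v - N' v)) (hW : ∀ v, 0 < W v) (hp : ∀ v, p * W v ≤ 1) (hZX0 : 0 < ZX)
    (huX : ∀ v, uX v = (NX v : ℝ) / W v / ZX) (huY : ∀ v, uY v = (NY v : ℝ) / W v / ZY) (hZ : ZX ≤ ZY) :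
    p * (Δ NX NY : ℝ) / ZX
      ≤ ∑ v, uX v * (if NY v < NX v then (1 : ℝ) else 0) - ∑ v, uY v * (if NY v < NX v then (1 : ℝ) else 0)
          - ∑ v, max (uY v - uX v) 0 * (if NX v = NY v then (1 : ℝ) else 0) := by
  rw [urn_posPart_C_eq_zero hW hZX0 huX huY hZ, sub_zero, ← sum_sub_distrib, hΔ, Nat.cast_sum, mul_sum, sum_div]
  refine sum_le_sum fun v _ => ?_
  rw [← sub_mul]
  by_cases hA : NY v < NX v
  · rw [if_pos hA, mul_one, Nat.cast_sub hA.le, huX, huY]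
    have hWv := hW v
    have h1 : (NY v : ℝ) / W v / ZY ≤ (NY v : ℝ) / W v / ZX :=
      div_le_div_of_nonneg_left (div_nonneg (Nat.cast_nonneg _) hWv.le) hZX0 hZ
    have h2 : p * ((NX v : ℝ) - NY v) / ZX ≤ (NX v : ℝ) / W v / ZX - (NY v : ℝ) / W v / ZX := by
      rw [← sub_div, ← sub_div]
      refine div_le_div_of_nonneg_right ?_ hZX0.le
      rw [le_div_iff₀ hWv]
      have hd : 0 ≤ (NX v : ℝ) - NY v := by
        have : (NY v : ℝ) ≤ NX v := by exact_mod_cast hA.le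
        linarith
      calc p * ((NX v : ℝ) - NY v) * W v = (p * W v) * ((NX v : ℝ) - NY v) := by ring
        _ ≤ 1 * ((NX v : ℝ) - NY v) := mul_le_mul_of_nonneg_right (hp v) hd
        _ = (NX v : ℝ) - NY v := one_mul _
    linarith
  · rw [if_neg hA, mul_zero, Nat.sub_eq_zero_of_le (not_lt.mp hA), Nat.cast_zero, mul_zero, zero_div]

omit [DecidableEq S] in
/-- **`Z_Y ≤ Z_X ⇒ G ≥ p·Δ(N_X,N_Y)/Z_Y`** (equal totals; by the symmetric form of the gain and `Δ(N_Y,N_X) = Δ(N_X,N_Y)`). [ours] -/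
theorem urn_gain_ge_of_ge (hΔ : ∀ N N', Δ N N' = ∑ v, (N v - N' v)) (hW : ∀ v, 0 < W v) (hp : ∀ v, p * W v ≤ 1)
    (hZX : ZX = ∑ v, (NX v : ℝ) / W v) (hZY : ZY = ∑ v, (NY v : ℝ) / W v) (hZX0 : 0 < ZX) (hZY0 : 0 < ZY)
    (huX : ∀ v, uX v = (NX v : ℝ) / W v / ZX) (huY : ∀ v, uY v = (NY v : ℝ) / W v / ZY) (htot : ∑ v, NX v = ∑ v, NY v) (hZ : ZY ≤ ZX) :
    p * (Δ NX NY : ℝ) / ZY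
      ≤ ∑ v, uX v * (if NY v < NX v then (1 : ℝ) else 0) - ∑ v, uY v * (if NY v < NX v then (1 : ℝ) else 0)
          - ∑ v, max (uY v - uX v) 0 * (if NX v = NY v then (1 : ℝ) else 0) := by
  have hmass : ∑ v, uX v = ∑ v, uY v := by
    rw [urn_law_sum_eq_one hZX hZX0 huX, urn_law_sum_eq_one hZY hZY0 huY]
  rw [hubGain_eq_posPart' NX NY hmass, cdist_symm_of_sum_eq hΔ htot]
  have h := urn_gain_ge_of_le (NX := NY) (NY := NX) hΔ hW hp hZY0 huY huX hZ
  have hC : ∑ v, max (uX v - uY v) 0 * (if NY v = NX v then (1 : ℝ) else 0) = ∑ v, max (uX v - uY v) 0 * (if NX v = NY v then (1 : ℝ) else 0) := by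
    refine sum_congr rfl fun v _ => ?_
    simp only [eq_comm]
  rw [hC] at h
  exact h

omit [DecidableEq S] in
/-- **THE URN GAIN: `G ≥ p·Δ(N_X,N_Y)/min{Z_X, Z_Y}`** (equal totals, `p·W ≤ 1`). [ours] -/
theorem urn_gain_ge_min (hΔ : ∀ N N', Δ N N' = ∑ v, (N v - N' v)) (hW : ∀ v, 0 < W v) (hp : ∀ v, p * W v ≤ 1)
    (hZX : ZX = ∑ v, (NX v : ℝ) / W v) (hZY : ZY = ∑ v, (NY v : ℝ) / W v) (hZX0 : 0 < ZX) (hZY0 : 0 < ZY)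
    (huX : ∀ v, uX v = (NX v : ℝ) / W v / ZX) (huY : ∀ v, uY v = (NY v : ℝ) / W v / ZY) (htot : ∑ v, NX v = ∑ v, NY v) :
    p * (Δ NX NY : ℝ) / min ZX ZY
      ≤ ∑ v, uX v * (if NY v < NX v then (1 : ℝ) else 0) - ∑ v, uY v * (if NY v < NX v then (1 : ℝ) else 0)
          - ∑ v, max (uY v - uX v) 0 * (if NX v = NY v then (1 : ℝ) else 0) := by
  rcases le_total ZX ZY with hZ | hZ
  · rw [min_eq_left hZ]; exact urn_gain_ge_of_le hΔ hW hp hZX0 huX huY hZ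
  · rw [min_eq_right hZ]; exact urn_gain_ge_of_ge hΔ hW hp hZX hZY hZX0 hZY0 huX huY htot hZ

/-! ## §4 The one-cycle contraction of the urn -/

/-- **THE URN CONTRACTS THE COMPOSITION DISTANCE BY `1 − p/min{Z_X,Z_Y}` PER CYCLE:** under the optimal coupling of the two deletions (common insertion),
`E[Δ(survivors)] ≤ Δ(N_X,N_Y) − p·Δ(N_X,N_Y)/min{Z_X,Z_Y}`. [ours] -/
theorem urn_bracket_le (hΔ : ∀ N N', Δ N N' = ∑ v, (N v - N' v)) (MX MY : S → S → ℕ) (hW : ∀ v, 0 < W v) (hp : ∀ v, p * W v ≤ 1)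
    (hZX : ZX = ∑ v, (NX v : ℝ) / W v) (hZY : ZY = ∑ v, (NY v : ℝ) / W v) (hZX0 : 0 < ZX) (hZY0 : 0 < ZY)
    (huX : ∀ v, uX v = (NX v : ℝ) / W v / ZX) (huY : ∀ v, uY v = (NY v : ℝ) / W v / ZY) (htot : ∑ v, NX v = ∑ v, NY v)
    (hMX : ∀ a, uX a ≠ 0 → NX = MX a + Pi.single a 1) (hMY : ∀ b, uY b ≠ 0 → NY = MY b + Pi.single b 1) :
    ∑ a, ∑ b, optimalCoupling uX uY a b * (Δ (MX a) (MY b) : ℝ) ≤ (Δ NX NY : ℝ) - p * (Δ NX NY : ℝ) / min ZX ZY := by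
  rw [hubBracket_optimal' hΔ NX NY MX MY (urn_law_nonneg hW hZX0 huX) (urn_law_nonneg hW hZY0 huY) (urn_law_sum_eq_one hZX hZX0 huX)
    (urn_law_sum_eq_one hZY hZY0 huY) hMX hMY]
  have h := urn_gain_ge_min hΔ hW hp hZX hZY hZX0 hZY0 huX huY htot
  linarith

/-- **Uniform form:** if `W ≥ W_lo > 0` and both compositions have `T` particles, the contraction factor is at most `1 − p·W_lo/T` (the double-pool worst case). [ours] -/
theorem urn_bracket_le_uniform (hΔ : ∀ N N', Δ N N' = ∑ v, (N v - N' v)) (MX MY : S → S → ℕ) (hW : ∀ v, 0 < W v) (hp0 : 0 ≤ p) (hp : ∀ v, p * W v ≤ 1)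
    (hZX : ZX = ∑ v, (NX v : ℝ) / W v) (hZY : ZY = ∑ v, (NY v : ℝ) / W v) (hZX0 : 0 < ZX) (hZY0 : 0 < ZY)
    (huX : ∀ v, uX v = (NX v : ℝ) / W v / ZX) (huY : ∀ v, uY v = (NY v : ℝ) / W v / ZY) (htot : ∑ v, NX v = ∑ v, NY v)
    (hMX : ∀ a, uX a ≠ 0 → NX = MX a + Pi.single a 1) (hMY : ∀ b, uY b ≠ 0 → NY = MY b + Pi.single b 1)
    {Wlo T : ℝ} (hWlo : 0 < Wlo) (hWge : ∀ v, Wlo ≤ W v) (hT : (∑ v, (NX v : ℝ)) = T) (hT0 : 0 < T) :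
    ∑ a, ∑ b, optimalCoupling uX uY a b * (Δ (MX a) (MY b) : ℝ) ≤ (1 - p * Wlo / T) * (Δ NX NY : ℝ) := by
  have h := urn_bracket_le hΔ MX MY hW hp hZX hZY hZX0 hZY0 huX huY htot hMX hMY
  have hZXle : ZX ≤ T / Wlo := by rw [← hT]; exact urn_Z_le hZX hWlo hWge
  have hZYle : ZY ≤ T / Wlo := by
    have hT' : (∑ v, (NY v : ℝ)) = T := by rw [← hT, ← Nat.cast_sum, ← Nat.cast_sum, htot]
    rw [← hT']; exact urn_Z_le hZY hWlo hWge
  have hmin0 : 0 < min ZX ZY := lt_min hZX0 hZY0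
  have hminle : min ZX ZY ≤ T / Wlo := (min_le_left _ _).trans hZXle
  have hΔ0 : 0 ≤ (Δ NX NY : ℝ) := Nat.cast_nonneg _
  -- `p Δ W_lo / T ≤ p Δ / min Z`
  have hkey : p * Wlo / T * (Δ NX NY : ℝ) ≤ p * (Δ NX NY : ℝ) / min ZX ZY := by
    rw [div_mul_eq_mul_div, le_div_iff₀ hmin0]
    calc p * Wlo * (Δ NX NY : ℝ) / T * min ZX ZY ≤ p * Wlo * (Δ NX NY : ℝ) / T * (T / Wlo) :=
          mul_le_mul_of_nonneg_left hminle (div_nonneg (mul_nonneg (mul_nonneg hp0 hWlo.le) hΔ0) hT0.le)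
      _ = p * (Δ NX NY : ℝ) := by field_simp
  calc ∑ a, ∑ b, optimalCoupling uX uY a b * (Δ (MX a) (MY b) : ℝ) ≤ (Δ NX NY : ℝ) - p * (Δ NX NY : ℝ) / min ZX ZY := h
    _ ≤ (Δ NX NY : ℝ) - p * Wlo / T * (Δ NX NY : ℝ) := by linarith
    _ = (1 - p * Wlo / T) * (Δ NX NY : ℝ) := by ring

end Urn

end Summit.Ventures.LatticeQCDFlow.Scaling
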